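import Literature.Topology.CoveringSpaces.CoveringGaloisCorrespondenceFinite
import Literature.Topology.CoveringSpaces.UniversalCoverAssociatedCovering
import HarnessLib

/-!
# The Galois correspondence for covering spaces: `Cov(X) ≌ π₁(X, x₀)-Set` and
# `Cov^fin(X) ≌ (finite π₁(X, x₀)-sets)` (Hatcher, Thm. 1.38; Grothendieck's form)

Topic `Literature/Topology/CoveringSpaces` — the EQUIVALENCE step of the topological Galois
correspondence (abc-iut cell, campaign-L R1, GAP row G-L4t14-R1), assembling
`CoveringGaloisCorrespondence(Finite).lean` (the fibre functors, fully faithful: step (D)) with the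
associated-covering construction `UniversalCoverAssociatedCovering.lean` (step (C): `X̃ ×_{π₁} S → X`
is a covering map whose fibre over `x₀` is `S`, equivariantly):

* `Cov.ofAction x₀ A` — the covering space `X̃ ×_{π₁} A` of a `π₁(X, x₀)`-set `A`;
  `Cov.fibreObjOfActionIso : (fibreFunctor x₀).obj (ofAction x₀ A) ≅ A`;
* `Cov.fibreFunctor_essSurj`, **`Cov.isEquivalence_fibreFunctor`**, **`Cov.galoisCorrespondence :
  Cov X ≌ Action (Type u) (FundamentalGroup X x₀)`** — for `X` path connected and strongly locally
  contractible (Mathlib `StronglyLocallyContractibleSpace`: contractible neighbourhoods form a basis,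
  e.g. manifolds, CW complexes; it implies locally path connected and semilocally simply connected);
* `CovFin.ofAction`, `CovFin.fibreFunctor_essSurj`, **`CovFin.isEquivalence_fibreFunctor`**,
  **`CovFin.galoisCorrespondence : CovFin X ≌ Action FintypeCat (FundamentalGroup X x₀)`** — the
  finite form («`Cov^fin(X) ≌ FinSet^{π₁(X,x)}`», the shape of the cell's MEMO-geometric-EA-residual
  §2 item 1; `Action FintypeCat G` is Mathlib's Galois category of finite `G`-sets).

Everything is proved; definitions: `Cov.ofAction`, `Cov.fibreObjOfActionIso`,
`Cov.galoisCorrespondence` and their `CovFin` twins.  No instances, no named facts.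

## References

* A. Hatcher, *Algebraic Topology*, CUP 2002, §1.3 Thm. 1.38 and p. 70 («This gives a one-to-one
  correspondence … covering spaces … actions of π₁(X,x₀) on F»). [HatcherAT2002]
* A. Grothendieck, M. Raynaud, SGA 1, Exp. V Thm. 4.1 / §5 («catégories galoisiennes»).
-/

noncomputable section

open CategoryTheory Function Set MulAction

universe u

namespace Literature.Topology.CoveringSpaces

variable {X : Type u} [TopologicalSpace X] [PathConnectedSpace X] [StronglyLocallyContractibleSpace X]
  (x₀ : X)

namespace Cov

/-- **The covering space `X̃ ×_{π₁} A → X` of a `π₁(X, x₀)`-set `A`** (`A` with the discrete topology),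
as an object of `Cov(X)`. [cite: HatcherAT2002, §1.3 p.70] -/
def ofAction (A : Action (Type u) (FundamentalGroup X x₀)) : Cov X :=
  letI : MulAction (FundamentalGroup X x₀) A.V := Action.instMulAction A
  letI : TopologicalSpace A.V := ⊥
  haveI : DiscreteTopology A.V := ⟨rfl⟩
  Cov.mk (assocProj (UniversalCover.isQuotientCoveringMap_proj (X := X) (x₀ := x₀)) A.V)
    UniversalCover.isCoveringMap_assocProj

/-- **The fibre of `X̃ ×_{π₁} A` over `x₀` is `A` as a `π₁(X, x₀)`-set** (the equivariant bijection
`assocFibreEquiv` of step (C), `UniversalCover.assocFibreEquiv_monodromy`).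
[cite: HatcherAT2002, §1.3 p.70] -/
def fibreObjOfActionIso (A : Action (Type u) (FundamentalGroup X x₀)) :
    (fibreFunctor x₀).obj (ofAction x₀ A) ≅ A :=
  letI : MulAction (FundamentalGroup X x₀) A.V := Action.instMulAction A
  letI : TopologicalSpace A.V := ⊥
  haveI : DiscreteTopology A.V := ⟨rfl⟩
  Action.mkIso
    (equivEquivIso
      (assocFibreEquiv (S := A.V) (UniversalCover.isQuotientCoveringMap_proj (X := X) (x₀ := x₀))
        (UniversalCover.base X x₀)))
    (fun γ ↦ by
      ext q
      exact UniversalCover.assocFibreEquiv_monodromy (X := X) (x₀ := x₀) (S := A.V) γ q)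

/-- **The fibre functor is essentially surjective**: every `π₁(X, x₀)`-set is the fibre of a covering
space (Hatcher Thm. 1.38, existence; `X` path connected and strongly locally contractible).
[cite: HatcherAT2002, §1.3 Thm. 1.38, p.70] -/
theorem fibreFunctor_essSurj : (fibreFunctor (X := X) x₀).EssSurj :=
  ⟨fun A ↦ ⟨ofAction x₀ A, ⟨fibreObjOfActionIso x₀ A⟩⟩⟩

/-- **The fibre functor `Cov(X) ⥤ π₁(X, x₀)-Set` is an equivalence of categories** (Hatcher
Thm. 1.38 + p.70; Grothendieck: the fibre functor of the topological Galois category).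
[cite: HatcherAT2002, §1.3 Thm. 1.38, p.70] -/
theorem isEquivalence_fibreFunctor : (fibreFunctor (X := X) x₀).IsEquivalence :=
  haveI := fibreFunctor_faithful (X := X) x₀
  haveI := fibreFunctor_full (X := X) x₀
  haveI := fibreFunctor_essSurj (X := X) x₀
  {}

/-- **THE GALOIS CORRESPONDENCE FOR COVERING SPACES**: `Cov(X) ≌ π₁(X, x₀)-Set` for `X` path
connected and strongly locally contractible. [cite: HatcherAT2002, §1.3 Thm. 1.38, p.70] -/
def galoisCorrespondence : Cov X ≌ Action (Type u) (FundamentalGroup X x₀) :=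
  haveI := isEquivalence_fibreFunctor (X := X) x₀
  (fibreFunctor x₀).asEquivalence

/-- The functor of the Galois correspondence is the fibre functor. [cite: HatcherAT2002, §1.3 Thm. 1.38] -/
@[simp] theorem galoisCorrespondence_functor :
    (galoisCorrespondence (X := X) x₀).functor = fibreFunctor x₀ := rfl

end Cov

namespace CovFin

/-- All fibres of `X̃ ×_{π₁} S` are in bijection with `S`: over `x = p a` the fibre is `S` by
`assocFibreEquiv … a`, and `p : X̃ → X` is onto. [cite: HatcherAT2002, §1.3 p.70] -/
theorem finite_preimage_assocProj {S : Type u} [MulAction (FundamentalGroup X x₀) S]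
    [TopologicalSpace S] [Finite S] (x : X) :
    Finite (assocProj (UniversalCover.isQuotientCoveringMap_proj (X := X) (x₀ := x₀)) S ⁻¹' {x}) := by
  obtain ⟨a, rfl⟩ := UniversalCover.proj_surjective (X := X) (x₀ := x₀) x
  exact Finite.of_equiv S
    (assocFibreEquiv (S := S) (UniversalCover.isQuotientCoveringMap_proj (X := X) (x₀ := x₀)) a).symm

/-- **The finite covering space `X̃ ×_{π₁} A → X` of a finite `π₁(X, x₀)`-set `A`**, as an object of
`Cov^fin(X)`. [cite: HatcherAT2002, §1.3 p.70] -/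
def ofAction (A : Action FintypeCat.{u} (FundamentalGroup X x₀)) : CovFin X :=
  letI : TopologicalSpace A.V := ⊥
  haveI : DiscreteTopology A.V := ⟨rfl⟩
  CovFin.mk (assocProj (UniversalCover.isQuotientCoveringMap_proj (X := X) (x₀ := x₀)) A.V)
    UniversalCover.isCoveringMap_assocProj (finite_preimage_assocProj x₀)

/-- The fibre of `X̃ ×_{π₁} A` over `x₀` is `A` as a finite `π₁(X, x₀)`-set.
[cite: HatcherAT2002, §1.3 p.70] -/
def fibreObjOfActionIso (A : Action FintypeCat.{u} (FundamentalGroup X x₀)) :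
    (fibreFunctor x₀).obj (ofAction x₀ A) ≅ A :=
  letI : TopologicalSpace A.V := ⊥
  haveI : DiscreteTopology A.V := ⟨rfl⟩
  Action.mkIso
    (FintypeCat.equivEquivIso
      (assocFibreEquiv (S := A.V) (UniversalCover.isQuotientCoveringMap_proj (X := X) (x₀ := x₀))
        (UniversalCover.base X x₀)))
    (fun γ ↦ by
      ext q
      exact UniversalCover.assocFibreEquiv_monodromy (X := X) (x₀ := x₀) (S := A.V) γ q)

/-- The finite fibre functor is essentially surjective. [cite: HatcherAT2002, §1.3 Thm. 1.38, p.70] -/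
theorem fibreFunctor_essSurj : (fibreFunctor (X := X) x₀).EssSurj :=
  ⟨fun A ↦ ⟨ofAction x₀ A, ⟨fibreObjOfActionIso x₀ A⟩⟩⟩

/-- **The finite fibre functor `Cov^fin(X) ⥤ Action FintypeCat π₁(X, x₀)` is an equivalence.**
[cite: HatcherAT2002, §1.3 Thm. 1.38, p.70] -/
theorem isEquivalence_fibreFunctor : (fibreFunctor (X := X) x₀).IsEquivalence :=
  haveI := fibreFunctor_faithful (X := X) x₀
  haveI := fibreFunctor_full (X := X) x₀
  haveI := fibreFunctor_essSurj (X := X) x₀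
  {}

/-- **THE GALOIS CORRESPONDENCE FOR FINITE COVERING SPACES**: `Cov^fin(X) ≌ FinSet^{π₁(X, x₀)}`
(`= Action FintypeCat (FundamentalGroup X x₀)`, Mathlib's Galois category of finite `π₁`-sets), for
`X` path connected and strongly locally contractible. [cite: HatcherAT2002, §1.3 Thm. 1.38, p.70] -/
def galoisCorrespondence : CovFin X ≌ Action FintypeCat.{u} (FundamentalGroup X x₀) :=
  haveI := isEquivalence_fibreFunctor (X := X) x₀
  (fibreFunctor x₀).asEquivalence

/-- The functor of the finite Galois correspondence is the finite fibre functor.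
[cite: HatcherAT2002, §1.3 Thm. 1.38] -/
@[simp] theorem galoisCorrespondence_functor :
    (galoisCorrespondence (X := X) x₀).functor = fibreFunctor x₀ := rfl

end CovFin

end Literature.Topology.CoveringSpaces

end
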